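import Summits.QuantumFields.YangMills.Theorems.ColdStartUniversalityLatticeLangevinRiemannLipschitzContraction
import Summits.QuantumFields.YangMills.Theorems.ColdStartUniversalityLatticeLangevinPlaquetteVariance
import Summits.QuantumFields.YangMills.Theorems.ColdStartUniversalityLatticeLangevinBakryEmeryConcentration
import HarnessLib

/-!
# Poincaré inequality and Gaussian concentration for LIPSCHITZ FUNCTIONS OF SHEN–ZHU–ZHU'S RIEMANNIAN METRIC `ρ_L` under the `SU(2)`
# Wilson measure on `(ℤ/L)³`, uniformly in the volume, `|β'| < 1/12`:  `Var ≤ Lip²/(1−12|β'|)`, `μ{F ≥ μF + r} ≤ e^(−(1−12|β'|) r²/(2 Lip²))`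

Seat `ym-line-csu-p1` (g41), route `ColdStartUniversality` of `Summits/QuantumFields/YangMills`, helper file G46 (`--supports stmt-QuantumFields-24809`).
The seat's Bakry–Émery package states the volume-uniform Poincaré inequality (g27 `wilson_variance_le_of_carre_uniform`) and Gaussian concentration
(g26 `wilson_concentration_uniform`) for cylinder functions with a bound `Γ^A(f) ≤ s` on the coordinate carré du champ, and (g30) for link-wise
FROBENIUS-Lipschitz functions.  With G44's `carre_le_two_mul_sq_of_riemannLipschitz` (`ρ_L`-Lipschitz ⇒ `Γ^A ≤ 2 Lip²`) they become statements about
Lipschitz functions of the METRIC MEASURE SPACE `(SU(2)^E, ρ_L, μ_(β'))`, `ρ_L` Shen–Zhu–Zhu's product Riemannian distance (a genuine metric by G45):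

* ★★ `wilson_variance_le_of_riemannLipschitz_uniform` — `Var_(μ_(β'))(F) ≤ L_F²/(1 − 12|β'|)` for every `C³` cylinder `F = f∘coords` which is
  `L_F`-Lipschitz for `ρ_L`, every `L` (Shen–Zhu–Zhu (4.11) in the intrinsic Lipschitz currency, `K_𝒮 ↦ 1 − 12|β'|`);
* ★★★ `wilson_concentration_riemannLipschitz_uniform` — `μ_(β'){μ_(β')F + r ≤ F} ≤ exp(−(1 − 12|β'|)·r²/(2L_F²))` (Gaussian concentration for
  Lipschitz functions of the Riemannian metric, uniform in the volume); ★★ `wilson_concentration_abs_riemannLipschitz_uniform` (two-sided, factor 2);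
* `abs_sub_integral_le_riemannLipschitz_diam` — the trivial companion `|F(Q) − μF| ≤ L_F·√2π·√#E` for ANY probability measure (diameter bound, G41).

THEOREMS ONLY, no definition, no sorry.  HONEST FRAMING: fixed cut-off, strong-coupling window `|β'| < 1/12` (uniform in `L` there); nothing at the
route's large `β'_K`, nothing `K`-uniform; `UniformColdStartMixing` (24809, ASIDE) not restated; no crux, rung or summit statement is proved; the
Yang–Mills mass gap is NOT proved.

References: H. Shen, R. Zhu, X. Zhu, CMP 400 (2023) 805–851, Thm 4.2, Cor. 4.4 (4.11)–(4.12) [ShenZhuZhu2022]; D. Bakry, I. Gentil, M. Ledoux,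
Grundlehren 348 (2014), Prop. 4.8.1, Prop. 5.4.1 (Herbst) [BakryGentilLedoux2014].
-/

set_option autoImplicit false

noncomputable section

namespace Summit.QuantumFields.YangMills.Theorems.ColdStartUniversality

open MeasureTheory ProbabilityTheory Matrix Complex Finset Filter Topology Set
open scoped ComplexConjugate BigOperators Real NNReal ENNReal
open Literature.MathematicalPhysics.QuantumFieldTheory
open Literature.MathematicalPhysics.QuantumLattice (fundamentalRep fundamentalLatticeRep continuous_fundamentalRep fundamentalRep_apply fundamentalLatticeRep_N)

variable {L : ℕ} [NeZero L]

/-! ## §1. The diameter bound (any probability measure) -/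

/-- `|F(Q) − ∫F dμ| ≤ L_F · √2·π·√#E` for an `L_F`-Lipschitz (in `ρ_L`) function and ANY probability measure `μ` on `SU(2)^E` for which `F` is
integrable: the oscillation of a Lipschitz function is at most `Lip × diam`, `diam_(ρ_L) ≤ √(2π²#E)` (G41). [cite: ShenZhuZhu2022, §4.1] -/
theorem abs_sub_integral_le_riemannLipschitz_diam {d : ℕ} {L : ℕ} [NeZero L] [MeasurableSpace (GaugeConfig d L (Matrix.specialUnitaryGroup (Fin 2) ℂ))]
    (μ : Measure (GaugeConfig d L (Matrix.specialUnitaryGroup (Fin 2) ℂ))) [IsProbabilityMeasure μ]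
    {F : GaugeConfig d L (Matrix.specialUnitaryGroup (Fin 2) ℂ) → ℝ} (hFint : Integrable F μ) {Lf : ℝ} (hLf : 0 ≤ Lf)
    (hlip : ∀ Q Q', |F Q' - F Q| ≤ Lf * Real.sqrt (torusRiemannDistSq (fundamentalLatticeRep 2) Q Q')) (Q : GaugeConfig d L (Matrix.specialUnitaryGroup (Fin 2) ℂ)) :
    |F Q - ∫ Q', F Q' ∂μ| ≤ Lf * (Real.sqrt 2 * Real.pi * Real.sqrt (Fintype.card (Edge d L))) := by
  have hdiam : ∀ Q', Real.sqrt (torusRiemannDistSq (fundamentalLatticeRep 2) Q' Q) ≤ Real.sqrt 2 * Real.pi * Real.sqrt (Fintype.card (Edge d L)) := by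
    intro Q'
    calc Real.sqrt (torusRiemannDistSq (fundamentalLatticeRep 2) Q' Q) ≤ Real.sqrt (2 * Real.pi ^ 2 * Fintype.card (Edge d L)) :=
          Real.sqrt_le_sqrt (torusRiemannDistSq_two_le_card Q' Q)
      _ = Real.sqrt 2 * Real.pi * Real.sqrt (Fintype.card (Edge d L)) := by
          rw [Real.sqrt_mul (by positivity), Real.sqrt_mul (by norm_num), Real.sqrt_sq Real.pi_pos.le]
  have hpt : ∀ Q', |F Q - F Q'| ≤ Lf * (Real.sqrt 2 * Real.pi * Real.sqrt (Fintype.card (Edge d L))) := fun Q' =>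
    (hlip Q' Q).trans (mul_le_mul_of_nonneg_left (hdiam Q') hLf)
  calc |F Q - ∫ Q', F Q' ∂μ| = |∫ Q', (F Q - F Q') ∂μ| := by
        rw [integral_sub (integrable_const _) hFint, integral_const, probReal_univ, one_smul]
    _ ≤ ∫ Q', |F Q - F Q'| ∂μ := abs_integral_le_integral_abs
    _ ≤ ∫ _Q', Lf * (Real.sqrt 2 * Real.pi * Real.sqrt (Fintype.card (Edge d L))) ∂μ :=
        integral_mono_of_nonneg (ae_of_all _ fun _ => abs_nonneg _) (integrable_const _) (ae_of_all _ hpt)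
    _ = Lf * (Real.sqrt 2 * Real.pi * Real.sqrt (Fintype.card (Edge d L))) := by rw [integral_const, probReal_univ, one_smul]

/-! ## §2. The Poincaré inequality in the `ρ_L`-Lipschitz currency -/

/-- ★★ **Volume-uniform Poincaré inequality for `ρ_L`-Lipschitz cylinder functions**: at `|β'| < 1/12`, for every `L` and every `C³` function `f` of
the real link coordinates whose restriction `F = f∘coords` is `L_F`-Lipschitz for Shen–Zhu–Zhu's Riemannian distance `ρ_L` on `SU(2)^E`:
`∫ (F − ∫F dμ_(β'))² dμ_(β') ≤ L_F²/(1 − 12|β'|)` — SZZ (4.11) with `Σ_e‖∇_eF‖²_∞` replaced by the intrinsic Lipschitz constant.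
[cite: ShenZhuZhu2022, Corollary 4.4 (4.11)] -/
theorem wilson_variance_le_of_riemannLipschitz_uniform (L : ℕ) [NeZero L] (β' : ℝ) (hβ : |β'| < 1 / 12)
    (f : (Edge 3 L × Fin 2 × Fin 2 × Bool → ℝ) → ℝ) (hf : ContDiff ℝ 3 f) {Lf : ℝ} (hLf : 0 ≤ Lf) :
    let coords : GaugeConfig 3 L (Matrix.specialUnitaryGroup (Fin 2) ℂ) → (Edge 3 L × Fin 2 × Fin 2 × Bool → ℝ) :=
      fun V q => (fun z : ℂ => if q.2.2.2 then z.im else z.re)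
        ((fundamentalRep (Fin 2) (V q.1) : Matrix (Fin 2) (Fin 2) ℂ) q.2.1 q.2.2.1)
    (∀ Q Q' : GaugeConfig 3 L (Matrix.specialUnitaryGroup (Fin 2) ℂ),
      |f (coords Q') - f (coords Q)| ≤ Lf * Real.sqrt (torusRiemannDistSq (fundamentalLatticeRep 2) Q Q')) →
    ∫ V, (f (coords V) - ∫ V', f (coords V') ∂(wilsonMeasure (d := 3) (L := L) (fundamentalRep (Fin 2)) β')) ^ 2
        ∂(wilsonMeasure (d := 3) (L := L) (fundamentalRep (Fin 2)) β') ≤ Lf ^ 2 / (1 - 12 * |β'|) := by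
  intro coords hlip
  have hΓ := carre_le_two_mul_sq_of_riemannLipschitz (L := L) β' (hf.differentiable (by norm_num)) hLf hlip
  have h := wilson_variance_le_of_carre_uniform L β' f hf (2 * Lf ^ 2) hβ hΓ
  have hρ : 0 < 1 - 12 * |β'| := by linarith
  calc _ ≤ 2 * Lf ^ 2 / (2 * (1 - 12 * |β'|)) := h
    _ = Lf ^ 2 / (1 - 12 * |β'|) := by field_simp

/-! ## §3. Gaussian concentration in the `ρ_L`-Lipschitz currency -/

/-- ★★★ **Volume-uniform Gaussian concentration for `ρ_L`-Lipschitz cylinder functions**: at `|β'| < 1/12`, for every `L`, every `C³` function `f`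
with `F = f∘coords` `L_F`-Lipschitz (`L_F > 0`) for `ρ_L` on `SU(2)^E`, and every `r ≥ 0`:
`μ_(β'){V | ∫F dμ_(β') + r ≤ F(V)} ≤ exp(−(1 − 12|β'|)·r²/(2 L_F²))` — Gaussian concentration of Lipschitz functions of the Riemannian metric
(log-Sobolev + Herbst), independent of the volume. [cite: BakryGentilLedoux2014, Prop. 5.4.1] -/
theorem wilson_concentration_riemannLipschitz_uniform (L : ℕ) [NeZero L] (β' : ℝ) (hβ : |β'| < 1 / 12)
    (f : (Edge 3 L × Fin 2 × Fin 2 × Bool → ℝ) → ℝ) (hf : ContDiff ℝ 3 f) {Lf : ℝ} (hLf : 0 < Lf) :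
    let coords : GaugeConfig 3 L (Matrix.specialUnitaryGroup (Fin 2) ℂ) → (Edge 3 L × Fin 2 × Fin 2 × Bool → ℝ) :=
      fun V q => (fun z : ℂ => if q.2.2.2 then z.im else z.re)
        ((fundamentalRep (Fin 2) (V q.1) : Matrix (Fin 2) (Fin 2) ℂ) q.2.1 q.2.2.1)
    (∀ Q Q' : GaugeConfig 3 L (Matrix.specialUnitaryGroup (Fin 2) ℂ),
      |f (coords Q') - f (coords Q)| ≤ Lf * Real.sqrt (torusRiemannDistSq (fundamentalLatticeRep 2) Q Q')) →
    ∀ r : ℝ, 0 ≤ r →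
      (wilsonMeasure (d := 3) (L := L) (fundamentalRep (Fin 2)) β').real
          {V | (∫ V', f (coords V') ∂(wilsonMeasure (d := 3) (L := L) (fundamentalRep (Fin 2)) β')) + r ≤ f (coords V)} ≤
        Real.exp (-((1 - 12 * |β'|) * r ^ 2 / (2 * Lf ^ 2))) := by
  intro coords hlip r hr
  have hΓ := carre_le_two_mul_sq_of_riemannLipschitz (L := L) β' (hf.differentiable (by norm_num)) hLf.le hlip
  exact wilson_concentration_uniform L β' hβ f hf (by positivity : (0 : ℝ) < 2 * Lf ^ 2) hΓ r hr

/-- ★★ **Two-sided Gaussian concentration for `ρ_L`-Lipschitz cylinder functions**: `μ_(β'){|F − ∫F dμ_(β')| ≥ r} ≤ 2·exp(−(1 − 12|β'|)·r²/(2 L_F²))`,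
every `L`, `|β'| < 1/12`. [cite: BakryGentilLedoux2014, Prop. 5.4.1] -/
theorem wilson_concentration_abs_riemannLipschitz_uniform (L : ℕ) [NeZero L] (β' : ℝ) (hβ : |β'| < 1 / 12)
    (f : (Edge 3 L × Fin 2 × Fin 2 × Bool → ℝ) → ℝ) (hf : ContDiff ℝ 3 f) {Lf : ℝ} (hLf : 0 < Lf) :
    let coords : GaugeConfig 3 L (Matrix.specialUnitaryGroup (Fin 2) ℂ) → (Edge 3 L × Fin 2 × Fin 2 × Bool → ℝ) :=
      fun V q => (fun z : ℂ => if q.2.2.2 then z.im else z.re)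
        ((fundamentalRep (Fin 2) (V q.1) : Matrix (Fin 2) (Fin 2) ℂ) q.2.1 q.2.2.1)
    (∀ Q Q' : GaugeConfig 3 L (Matrix.specialUnitaryGroup (Fin 2) ℂ),
      |f (coords Q') - f (coords Q)| ≤ Lf * Real.sqrt (torusRiemannDistSq (fundamentalLatticeRep 2) Q Q')) →
    ∀ r : ℝ, 0 ≤ r →
      (wilsonMeasure (d := 3) (L := L) (fundamentalRep (Fin 2)) β').real
          {V | r ≤ |f (coords V) - ∫ V', f (coords V') ∂(wilsonMeasure (d := 3) (L := L) (fundamentalRep (Fin 2)) β')|} ≤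
        2 * Real.exp (-((1 - 12 * |β'|) * r ^ 2 / (2 * Lf ^ 2))) := by
  intro coords hlip r hr
  classical
  haveI := secondCountableTopology_su2
  haveI := borelSpace_config L
  set μ : Measure (GaugeConfig 3 L (Matrix.specialUnitaryGroup (Fin 2) ℂ)) := wilsonMeasure (d := 3) (L := L) (fundamentalRep (Fin 2)) β' with hμ
  haveI : IsProbabilityMeasure μ :=
    isProbabilityMeasure_wilsonMeasure (d := 3) (L := L) (fundamentalRep (Fin 2)) (continuous_fundamentalRep (Fin 2)) β'
  -- upper tail for `f`, lower tail = upper tail for `−f`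
  have hup := wilson_concentration_riemannLipschitz_uniform L β' hβ f hf hLf hlip r hr
  have hneg : ContDiff ℝ 3 (fun x => -f x) := hf.neg
  have hlipneg : ∀ Q Q' : GaugeConfig 3 L (Matrix.specialUnitaryGroup (Fin 2) ℂ),
      |(-f (coords Q')) - (-f (coords Q))| ≤ Lf * Real.sqrt (torusRiemannDistSq (fundamentalLatticeRep 2) Q Q') := by
    intro Q Q'; rw [show (-f (coords Q')) - (-f (coords Q)) = -(f (coords Q') - f (coords Q)) by ring, abs_neg]; exact hlip Q Q'
  have hdown := wilson_concentration_riemannLipschitz_uniform L β' hβ (fun x => -f x) hneg hLf hlipneg r hr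
  have hm : ∫ V', -f (coords V') ∂μ = -∫ V', f (coords V') ∂μ := integral_neg _
  have hsub : {V | r ≤ |f (coords V) - ∫ V', f (coords V') ∂μ|} ⊆
      {V | (∫ V', f (coords V') ∂μ) + r ≤ f (coords V)} ∪ {V | (∫ V', -f (coords V') ∂μ) + r ≤ -f (coords V)} := by
    intro V hV
    simp only [Set.mem_setOf_eq, Set.mem_union] at hV ⊢
    rw [hm]
    rcases le_abs'.1 hV with h | h
    · right; linarith
    · left; linarith
  calc μ.real {V | r ≤ |f (coords V) - ∫ V', f (coords V') ∂μ|}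
      ≤ μ.real ({V | (∫ V', f (coords V') ∂μ) + r ≤ f (coords V)} ∪ {V | (∫ V', -f (coords V') ∂μ) + r ≤ -f (coords V)}) :=
        measureReal_mono hsub
    _ ≤ μ.real {V | (∫ V', f (coords V') ∂μ) + r ≤ f (coords V)} + μ.real {V | (∫ V', -f (coords V') ∂μ) + r ≤ -f (coords V)} :=
        measureReal_union_le _ _
    _ ≤ Real.exp (-((1 - 12 * |β'|) * r ^ 2 / (2 * Lf ^ 2))) + Real.exp (-((1 - 12 * |β'|) * r ^ 2 / (2 * Lf ^ 2))) := add_le_add hup hdown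
    _ = 2 * Real.exp (-((1 - 12 * |β'|) * r ^ 2 / (2 * Lf ^ 2))) := by ring

end Summit.QuantumFields.YangMills.Theorems.ColdStartUniversality

end
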